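import Literature.Geometry.Lorentzian.BogovskiiScalarGluing
import Literature.Geometry.Lorentzian.BogovskiiGluingVec
import HarnessLib

/-!
# Smooth compactly supported symmetric anti-divergence from the scalar one

(trunk G08 = T-LORENTZ; family `gr`; namespace `Literature.Geometry.Lorentzian.MaoOhTao`.)

The symmetric divergence equation `Σ_i ∂_i z^{ij} = F^j`, `z^{ij} = z^{ji}`, with `z` compactly supported in an open set
`U ⊇ supp F`, is solvable exactly when the six Killing moments `∫ F·e_l`, `∫ F·(e_l × x)` vanish (Mao–Oh–Tao,
arXiv:2308.13031, Lemma 2.2 (T2); the tree has the weak form on the annulus, `BogovskiiGluingVec.lean`, and the pointwise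
linear operator `annulusT` with support in the CLOSED annulus, `BogovskiiAnnulusOperatorVec.lean`).  This file derives
smooth, compactly supported solutions on ANY set `U` on which the scalar equation `div w = h` has smooth compactly
supported solutions (`BogovskiiScalarDivergence.lean`, `BogovskiiScalarGluing.lean`), by the classical symmetrisation
trick (two applications of the scalar inverse):

1. rows: `Σ_i ∂_i W^{ij} = F^j` with `W^{·j}` compactly supported in `U` (`∫ F^j = 0`);
2. the antisymmetric part `A^{ij} = W^{ij} − W^{ji}` has zero mass, since `∫ W^{ij} = −∫ x_i F^j` and
   `∫ (x_i F^j − x_j F^i) = 0` (rotation moments); so `A^{ij} = Σ_k ∂_k v^{ijk}` with `v^{ijk} = −v^{jik}` compactly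
   supported in `U` (solve for each pair and antisymmetrise);
3. `z^{ij} = ½(W^{ij} + W^{ji}) + ½ Σ_k ∂_k (v^{kji} + v^{kij})` is symmetric, and
   `Σ_i ∂_i z^{ij} = F^j − ½ Σ_i ∂_i A^{ij} + ½ Σ_{i,k} ∂_i∂_k v^{kji} + ½ Σ_{i,k} ∂_i∂_k v^{kij} = F^j`
   (the last double sum vanishes by antisymmetry, the previous one is `Σ_k ∂_k A^{kj}`).

* `exists_smooth_symmDivInverse_of_divInverse` — the trick on a general `U`;
* `exists_smooth_symmDivInverse_shell` — **smooth compactly supported symmetric anti-divergence on spherical shells**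
  `{a < |x| < b}`, `0 < a` (with `exists_smooth_divInverse_shell`);
* `exists_smooth_symmDivInverse_of_convex` — the same on nonempty convex open sets.

Everything is proved; no definitions, no named facts.

## References

* Y. Mao, S.-J. Oh, T. Tao, arXiv:2308.13031 (2023), Lemma 2.2 (T1)–(T2) and its proof, pp. 8–9 (key `MaoOhTao2023`).
* G. P. Galdi, *An Introduction to the Mathematical Theory of the Navier–Stokes Equations. Steady-State Problems*,
  2nd ed., Springer (2011), Theorem III.3.3 (key `Galdi2011`).
-/

noncomputable section

open scoped RealInnerProductSpace Topology ContDiff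
open Filter MeasureTheory Set Metric Function

namespace Literature.Geometry.Lorentzian

namespace MaoOhTao

/-! ### Calculus helpers -/

section Helpers

variable {x : E3} {m : Fin 3}

/-- The partials of a smooth function are smooth. [folklore] -/
theorem contDiff_infty_pd {f : E3 → ℝ} (hf : ContDiff ℝ ∞ f) (m : Fin 3) : ContDiff ℝ ∞ (pd m f) :=
  contDiff_infty.2 fun n ↦ contDiff_pd (hf.of_le (by exact_mod_cast le_top)) m

/-- `∂_m (−f) = −∂_m f`. [folklore] -/
theorem pd_neg_fun (f : E3 → ℝ) : pd m (fun y ↦ -f y) x = -pd m f x := by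
  simp [pd, fderiv_fun_neg]

/-- The partials of a function vanish off its topological support. [folklore] -/
theorem pd_eq_zero_of_notMem_tsupport {f : E3 → ℝ} (hx : x ∉ tsupport f) (m : Fin 3) : pd m f x = 0 :=
  pd_eq_zero_of_forall_mem (isClosed_tsupport f).isOpen_compl (fun _ hy ↦ image_eq_zero_of_notMem_tsupport hy) hx m

/-- The topological support of a partial derivative lies in that of the function. [folklore] -/
theorem tsupport_pd_subset (f : E3 → ℝ) (m : Fin 3) : tsupport (pd m f) ⊆ tsupport f :=
  closure_minimal (fun _ hx ↦ by_contra fun h ↦ (mem_support.1 hx) (pd_eq_zero_of_notMem_tsupport h m))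
    (isClosed_tsupport f)

/-- A function vanishing off a closed set `S ⊆ U` has topological support in `U`. [folklore] -/
theorem tsupport_subset_of_eq_zero {f : E3 → ℝ} {S U : Set E3} (hS : IsClosed S) (hSU : S ⊆ U)
    (hf : ∀ x ∉ S, f x = 0) : tsupport f ⊆ U :=
  (closure_minimal (fun x hx ↦ by_contra fun h ↦ (mem_support.1 hx) (hf x h)) hS).trans hSU

/-- **`∫ x_m div w = −∫ w^m`** for a `C¹` compactly supported field. [folklore] -/
theorem integral_coord_mul_sum_pd_eq {w : Fin 3 → E3 → ℝ} (hw : ∀ l, ContDiff ℝ 1 (w l))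
    (hwc : ∀ l, HasCompactSupport (w l)) (m : Fin 3) :
    ∫ y : E3, y m * ∑ l, pd l (w l) y = -∫ y : E3, w m y := by
  have hI : ∀ l, Integrable fun y : E3 ↦ y m * pd l (w l) y := fun l ↦
    ((EuclideanSpace.proj (𝕜 := ℝ) m).continuous.mul
      (((hw l).continuous_fderiv one_ne_zero).clm_apply continuous_const)).integrable_of_hasCompactSupport
      (hasCompactSupport_pd (hwc l) l).mul_left
  simp only [Finset.mul_sum]
  rw [integral_finsetSum _ fun l _ ↦ hI l]
  have hl : ∀ l, ∫ y : E3, y m * pd l (w l) y = -∫ y : E3, w l y * (if m = l then 1 else 0) := by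
    intro l
    rw [integral_congr_ae (ae_of_all _ fun y ↦ mul_comm (y m) (pd l (w l) y)),
      integral_pd_mul_eq_neg (hw l) (hwc l) (contDiff_coord m) l]
    simp only [pd_coord]
  rw [Finset.sum_eq_single_of_mem m (Finset.mem_univ m) (fun l _ hl' ↦ by rw [hl l, if_neg (Ne.symm hl')]; simp),
    hl m, if_pos rfl]
  simp

end Helpers

/-! ### The symmetrisation trick -/

section Symm

/-- **Smooth compactly supported symmetric anti-divergence from the scalar one.**  Suppose that on `U` every
`h ∈ C_c^∞` with `tsupp h ⊆ U`, `∫ h = 0` is `Σ_a ∂ₐ w^a` for a smooth field compactly supported inside `U`.  Then every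
smooth compactly supported vector density `F` with `tsupp F^k ⊆ U` and vanishing Killing moments
`∫ F·e_l = ∫ F·(e_l × x) = 0` is `F^j = Σ_i ∂_i z^{ij}` for a SYMMETRIC smooth field `z` compactly supported inside `U`:
`z^{ij} = ½(W^{ij} + W^{ji}) + ½ Σ_k ∂_k (v^{kji} + v^{kij})`, where `Σ_i ∂_i W^{ij} = F^j` row by row and
`Σ_k ∂_k v^{ijk} = W^{ij} − W^{ji}` with `v` antisymmetric in `ij` (the antisymmetric part has zero mass by the rotation
moments). [cite: MaoOhTao2023, Lemma 2.2 (T1)–(T2)] -/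
theorem exists_smooth_symmDivInverse_of_divInverse {U : Set E3}
    (hU : ∀ h : E3 → ℝ, ContDiff ℝ ∞ h → HasCompactSupport h → tsupport h ⊆ U → ∫ x, h x = 0 →
      ∃ w : Fin 3 → E3 → ℝ, (∀ a, ContDiff ℝ ∞ (w a)) ∧ (∀ a, HasCompactSupport (w a)) ∧
        (∀ a, tsupport (w a) ⊆ U) ∧ ∀ x, ∑ a, pd a (w a) x = h x)
    (F : Fin 3 → E3 → ℝ) (hF : ∀ k, ContDiff ℝ ∞ (F k)) (hFc : ∀ k, HasCompactSupport (F k))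
    (hFU : ∀ k, tsupport (F k) ⊆ U) (hK : ∀ a, ∫ y : E3, ∑ j, F j y * killingFn a y j = 0) :
    ∃ z : Fin 3 → Fin 3 → E3 → ℝ, (∀ i j x, z i j x = z j i x) ∧ (∀ i j, ContDiff ℝ ∞ (z i j)) ∧
      (∀ i j, HasCompactSupport (z i j)) ∧ (∀ i j, tsupport (z i j) ⊆ U) ∧
      ∀ j x, ∑ i, pd i (z i j) x = F j x := by
  have hF0 := killing_moments_translation hK
  have hFA := killing_moments_rotation (fun k ↦ (hF k).continuous) hFc hK
  have hne1 : ((1 : ℕ) : ℕ∞ω) ≤ ∞ := by exact_mod_cast le_top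
  -- Step 1: the rows `Σ_i ∂_i W^{ij} = F^j` (`W j i = W^{ij}`)
  choose W hW hWc hWU hWd using fun j ↦ hU (F j) (hF j) (hFc j) (hFU j) (hF0 j)
  have dW : ∀ a c (y : E3), DifferentiableAt ℝ (W a c) y := fun a c y ↦ (hW a c).differentiable (by simp) y
  have hWint : ∀ j m, ∫ y : E3, W j m y = -∫ y : E3, y m * F j y := by
    intro j m
    have h := integral_coord_mul_sum_pd_eq (w := W j) (fun l ↦ (hW j l).of_le hne1) (hWc j) m
    simp only [hWd j] at h
    rw [h, neg_neg]
  -- Step 2: the antisymmetric parts `A^{ij} = W^{ij} − W^{ji}` have zero mass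
  set A : Fin 3 → Fin 3 → E3 → ℝ := fun i j y ↦ W j i y - W i j y with hAdef
  have hA : ∀ i j, ContDiff ℝ ∞ (A i j) := fun i j ↦ (hW j i).sub (hW i j)
  have hAc : ∀ i j, HasCompactSupport (A i j) := fun i j ↦ (hWc j i).sub (hWc i j)
  have hAU : ∀ i j, tsupport (A i j) ⊆ U := fun i j ↦
    tsupport_subset_of_eq_zero ((isClosed_tsupport _).union (isClosed_tsupport _)) (union_subset (hWU j i) (hWU i j))
      fun x hx ↦ by
        rw [mem_union, not_or] at hx
        simp [hAdef, image_eq_zero_of_notMem_tsupport hx.1, image_eq_zero_of_notMem_tsupport hx.2]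
  have hA0 : ∀ i j, ∫ y, A i j y = 0 := by
    intro i j
    have I : ∀ a c, Integrable (W a c) := fun a c ↦ (hW a c).continuous.integrable_of_hasCompactSupport (hWc a c)
    simp only [hAdef]
    rw [integral_sub (I j i) (I i j), hWint j i, hWint i j, hFA i j]
    ring
  -- Step 3: `A^{ij} = Σ_k ∂_k v^{ijk}` with `v` antisymmetric in `ij`
  choose v hv hvc hvU hvd using fun i j ↦ hU (A i j) (hA i j) (hAc i j) (hAU i j) (hA0 i j)
  set vt : Fin 3 → Fin 3 → Fin 3 → E3 → ℝ := fun i j k y ↦ (1 / 2 : ℝ) * (v i j k y - v j i k y) with hvtdef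
  have hvt : ∀ i j k, ContDiff ℝ ∞ (vt i j k) := fun i j k ↦ contDiff_const.mul ((hv i j k).sub (hv j i k))
  have hvtc : ∀ i j k, HasCompactSupport (vt i j k) := fun i j k ↦ ((hvc i j k).sub (hvc j i k)).mul_left
  have hvtU : ∀ i j k, tsupport (vt i j k) ⊆ U := fun i j k ↦
    tsupport_subset_of_eq_zero ((isClosed_tsupport _).union (isClosed_tsupport _))
      (union_subset (hvU i j k) (hvU j i k)) fun x hx ↦ by
        rw [mem_union, not_or] at hx
        simp [hvtdef, image_eq_zero_of_notMem_tsupport hx.1, image_eq_zero_of_notMem_tsupport hx.2]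
  have hvt_anti : ∀ i j k y, vt j i k y = -vt i j k y := by
    intro i j k y
    simp only [hvtdef]
    ring
  have dpv : ∀ a c k m (y : E3), DifferentiableAt ℝ (pd m (vt a c k)) y := fun a c k m y ↦
    (contDiff_infty_pd (hvt a c k) m).differentiable (by simp) y
  have hvtd : ∀ i j y, ∑ k, pd k (vt i j k) y = A i j y := by
    intro i j y
    have e1 : ∀ k, pd k (vt i j k) y = (1 / 2 : ℝ) * (pd k (v i j k) y - pd k (v j i k) y) := by
      intro k
      have d1 := (hv i j k).differentiable (by simp) y
      have d2 := (hv j i k).differentiable (by simp) y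
      have h1 := pd_const_mul' (m := k) (x := y) (1 / 2 : ℝ) (f := fun y' ↦ v i j k y' - v j i k y') (d1.sub d2)
      beta_reduce at h1
      simp only [hvtdef]
      rw [h1, pd_sub d1 d2]
    simp only [e1, ← Finset.mul_sum, Finset.sum_sub_distrib, hvd i j y, hvd j i y, hAdef]
    ring
  have hcomm : ∀ a c k i m (y : E3), pd i (pd m (vt a c k)) y = pd m (pd i (vt a c k)) y := fun a c k i m y ↦
    pd_pd_comm ((hvt a c k).of_le (by norm_cast)).contDiffAt i m
  -- Step 4: the symmetric tensor
  set z : Fin 3 → Fin 3 → E3 → ℝ := fun i j y ↦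
    (1 / 2 : ℝ) * (W j i y + W i j y) + (1 / 2 : ℝ) * ∑ k, (pd k (vt k j i) y + pd k (vt k i j) y) with hzdef
  -- its support
  have hzS : ∀ i j, ∃ S : Set E3, IsCompact S ∧ IsClosed S ∧ S ⊆ U ∧ ∀ y ∉ S, z i j y = 0 := by
    intro i j
    refine ⟨(tsupport (W j i) ∪ tsupport (W i j)) ∪ ⋃ k, (tsupport (vt k j i) ∪ tsupport (vt k i j)),
      ((hWc j i).union (hWc i j)).union (isCompact_iUnion fun k ↦ (hvtc k j i).union (hvtc k i j)),
      ((isClosed_tsupport _).union (isClosed_tsupport _)).union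
        (isClosed_iUnion_of_finite fun k ↦ (isClosed_tsupport _).union (isClosed_tsupport _)),
      union_subset (union_subset (hWU j i) (hWU i j)) (iUnion_subset fun k ↦ union_subset (hvtU k j i) (hvtU k i j)),
      fun y hy ↦ ?_⟩
    simp only [mem_union, mem_iUnion, not_or, not_exists] at hy
    obtain ⟨⟨h1, h2⟩, h3⟩ := hy
    have h4 : ∀ k, pd k (vt k j i) y = 0 := fun k ↦ pd_eq_zero_of_notMem_tsupport (h3 k).1 k
    have h5 : ∀ k, pd k (vt k i j) y = 0 := fun k ↦ pd_eq_zero_of_notMem_tsupport (h3 k).2 k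
    simp [hzdef, image_eq_zero_of_notMem_tsupport h1, image_eq_zero_of_notMem_tsupport h2, h4, h5]
  refine ⟨z, fun i j y ↦ ?_, fun i j ↦ ?_, fun i j ↦ ?_, fun i j ↦ ?_, fun j y ↦ ?_⟩
  · -- symmetry
    simp only [hzdef]
    rw [add_comm (W j i y) (W i j y), Finset.sum_congr rfl fun k _ ↦ add_comm (pd k (vt k j i) y) (pd k (vt k i j) y)]
  · -- smoothness
    exact (contDiff_const.mul ((hW j i).add (hW i j))).add (contDiff_const.mul
      (ContDiff.sum fun k _ ↦ (contDiff_infty_pd (hvt k j i) k).add (contDiff_infty_pd (hvt k i j) k)))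
  · -- compact support
    obtain ⟨S, hSc, -, -, hS0⟩ := hzS i j
    exact HasCompactSupport.intro hSc hS0
  · -- support in `U`
    obtain ⟨S, -, hScl, hSU, hS0⟩ := hzS i j
    exact tsupport_subset_of_eq_zero hScl hSU hS0
  · -- the divergence
    have hpdz : ∀ i, pd i (z i j) y = (1 / 2 : ℝ) * (pd i (W j i) y + pd i (W i j) y) +
        (1 / 2 : ℝ) * ∑ k, (pd i (pd k (vt k j i)) y + pd i (pd k (vt k i j)) y) := by
      intro i
      have h0 := (((dW j i y).hasFDerivAt.add (dW i j y).hasFDerivAt).const_mul (1 / 2 : ℝ)).add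
        ((HasFDerivAt.sum (u := Finset.univ) fun k _ ↦
          ((dpv k j i k y).hasFDerivAt.add (dpv k i j k y).hasFDerivAt)).const_mul (1 / 2 : ℝ))
      have h : HasFDerivAt (z i j) ((1 / 2 : ℝ) • (fderiv ℝ (W j i) y + fderiv ℝ (W i j) y) +
          (1 / 2 : ℝ) • ∑ k, (fderiv ℝ (pd k (vt k j i)) y + fderiv ℝ (pd k (vt k i j)) y)) y :=
        h0.congr_of_eventuallyEq (Eventually.of_forall fun y' ↦ by simp only [hzdef, Finset.sum_apply, Pi.add_apply])
      rw [show pd i (z i j) y = fderiv ℝ (z i j) y (e i) from rfl, h.fderiv]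
      simp only [_root_.add_apply, FunLike.coe_smul, Pi.smul_apply, FunLike.coe_sum, Finset.sum_apply, smul_eq_mul]
      rfl
    have hsumW : ∑ i, pd i (W i j) y = F j y - ∑ i, pd i (A i j) y := by
      have e : ∀ i, pd i (A i j) y = pd i (W j i) y - pd i (W i j) y := fun i ↦ pd_sub (dW j i y) (dW i j y)
      simp only [e, Finset.sum_sub_distrib, hWd j y]
      ring
    have hT1 : ∑ i, ∑ k, pd i (pd k (vt k j i)) y = ∑ k, pd k (A k j) y := by
      rw [Finset.sum_comm]
      refine Finset.sum_congr rfl fun k _ ↦ ?_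
      have hfun : A k j = fun y' ↦ ∑ i, pd i (vt k j i) y' := funext fun y' ↦ (hvtd k j y').symm
      rw [hfun, pd_sum Finset.univ (fun i ↦ pd i (vt k j i)) fun i _ ↦ dpv k j i i y]
      exact Finset.sum_congr rfl fun i _ ↦ hcomm k j i i k y
    have hT2 : ∑ i, ∑ k, pd i (pd k (vt k i j)) y = 0 := by
      have hanti : ∀ i k, pd i (pd k (vt k i j)) y = -pd k (pd i (vt i k j)) y := by
        intro i k
        rw [hcomm]
        have hf : vt k i j = fun y' ↦ -vt i k j y' := funext fun y' ↦ hvt_anti i k j y'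
        have hf' : pd i (fun y' ↦ -vt i k j y') = fun y' ↦ -pd i (vt i k j) y' := funext fun y' ↦ pd_neg_fun _
        rw [hf, hf', pd_neg_fun]
      have hS : ∑ i, ∑ k, pd i (pd k (vt k i j)) y = -∑ i, ∑ k, pd i (pd k (vt k i j)) y :=
        calc ∑ i, ∑ k, pd i (pd k (vt k i j)) y = ∑ i, ∑ k, -pd k (pd i (vt i k j)) y :=
              Finset.sum_congr rfl fun i _ ↦ Finset.sum_congr rfl fun k _ ↦ hanti i k
          _ = -∑ i, ∑ k, pd k (pd i (vt i k j)) y := by simp only [Finset.sum_neg_distrib]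
          _ = -∑ i, ∑ k, pd i (pd k (vt k i j)) y := by rw [Finset.sum_comm]
      linarith
    rw [Finset.sum_congr rfl fun i _ ↦ hpdz i]
    simp only [mul_add, Finset.sum_add_distrib, ← Finset.mul_sum]
    linarith [hWd j y, hsumW, hT1, hT2]

/-- **Smooth compactly supported symmetric anti-divergence on spherical shells.**  For `0 < a` and a smooth compactly
supported vector density `F` with `tsupp F^k ⊆ {a < |x| < b}` and vanishing Killing moments there is a symmetric smooth
field `z` with compact support, `tsupp z^{ij} ⊆ {a < |x| < b}`, and `Σ_i ∂_i z^{ij} = F^j` pointwise.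
[cite: MaoOhTao2023, Lemma 2.2 (T1)–(T2)] -/
theorem exists_smooth_symmDivInverse_shell {a b : ℝ} (ha : 0 < a) (F : Fin 3 → E3 → ℝ)
    (hF : ∀ k, ContDiff ℝ ∞ (F k)) (hFc : ∀ k, HasCompactSupport (F k))
    (hFU : ∀ k, tsupport (F k) ⊆ {x : E3 | a < ‖x‖ ∧ ‖x‖ < b})
    (hK : ∀ a', ∫ y : E3, ∑ j, F j y * killingFn a' y j = 0) :
    ∃ z : Fin 3 → Fin 3 → E3 → ℝ, (∀ i j x, z i j x = z j i x) ∧ (∀ i j, ContDiff ℝ ∞ (z i j)) ∧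
      (∀ i j, HasCompactSupport (z i j)) ∧ (∀ i j, tsupport (z i j) ⊆ {x : E3 | a < ‖x‖ ∧ ‖x‖ < b}) ∧
      ∀ j x, ∑ i, pd i (z i j) x = F j x :=
  exists_smooth_symmDivInverse_of_divInverse (fun h hh hhc hhU hh0 ↦ exists_smooth_divInverse_shell ha h hh hhc hhU hh0)
    F hF hFc hFU hK

/-- **Smooth compactly supported symmetric anti-divergence on nonempty convex open sets** (e.g. balls).
[cite: MaoOhTao2023, Lemma 2.3 (T1)–(T2)] -/
theorem exists_smooth_symmDivInverse_of_convex {Ω : Set E3} (hΩo : IsOpen Ω) (hΩc : Convex ℝ Ω) (hΩn : Ω.Nonempty)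
    (F : Fin 3 → E3 → ℝ) (hF : ∀ k, ContDiff ℝ ∞ (F k)) (hFc : ∀ k, HasCompactSupport (F k))
    (hFU : ∀ k, tsupport (F k) ⊆ Ω) (hK : ∀ a, ∫ y : E3, ∑ j, F j y * killingFn a y j = 0) :
    ∃ z : Fin 3 → Fin 3 → E3 → ℝ, (∀ i j x, z i j x = z j i x) ∧ (∀ i j, ContDiff ℝ ∞ (z i j)) ∧
      (∀ i j, HasCompactSupport (z i j)) ∧ (∀ i j, tsupport (z i j) ⊆ Ω) ∧ ∀ j x, ∑ i, pd i (z i j) x = F j x :=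
  exists_smooth_symmDivInverse_of_divInverse (fun h hh hhc hhU hh0 ↦
    exists_smooth_divInverse_of_convex hΩo hΩc hΩn h hh hhc hhU hh0) F hF hFc hFU hK

end Symm

end MaoOhTao

end Literature.Geometry.Lorentzian

end
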